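import Summits.NavierStokesRegularity.OSWSelfSimilar.SheetNSLineTorusCascadeExistence
import HarnessLib

/-!
# Viscous CLM on the torus (`a = 0`, `σ = 2`): the `(ν, c)` SCALING DICTIONARY of the sine-datum cascade — amplitude homogeneity,
# time/viscosity scaling, and the universal family: `c_k^{(ν,c)}(t) = ν (c/ν)^k E_k(νt)` with `E = cascadeSolution 1 (sineDatum 1)`

HONEST FRAMING (cell ns-blowup GROUP B «PROFILE SEARCH», zone Z3, row Z3-U addendum A-F2 of `HOME/profile/z3/CENSUS-Z3.md`;
human rulings D-0035/D-0074; Z3-TWIN lineage): **1-D MODEL (viscous Constantin–Lax–Majda equation `ω_t = ω Hω + ν ω_xx` on `𝕋`);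
ODE algebra on Fourier-coefficient families, kernel-checked; not Euler, not Navier–Stokes; «violates: none — MODEL».**

OBJECT: the sine-datum cascade `IsSineCascade ν c e` of `SheetNSLineTorusCascade` (`ċ_k = ½ Σ_{i+j=k} c_i c_j − ν k² c_k`,
`c_0 ≡ 0`, `c_1(0) = c`, `c_k(0) = 0` for `k ≥ 2`) and the explicit object `cascadeSolution ν (sineDatum c)` of
`SheetNSLineTorusCascadeExistence` (global existence + uniqueness, p507796). The cascade has two exact symmetries:

* `IsSineCascade.smul_pow` — **amplitude homogeneity**: `(k, t) ↦ λ^k c_k(t)` is the sine cascade with datum `λc` (same `ν`), for every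
  real `λ` (the quadratic convolution is graded: `λ^i λ^j = λ^k` on the antidiagonal `i + j = k`);
* `IsSineCascade.timeScale` — **time/viscosity scaling**: `(k, t) ↦ κ c_k(κt)` is the sine cascade with viscosity `κν` and datum `κc`,
  for every `κ > 0`.
Consequently (uniqueness, `IsSineCascade.unique`) every sine cascade is an explicit rescaling of ONE universal family
`E := cascadeSolution 1 (sineDatum 1)` (`ν = 1`, `c = 1`; `E_1(τ) = e^{−τ}`):
* `isSineCascade_universal_scaled` — `(k, t) ↦ ν (c/ν)^k E_k(νt)` is a sine cascade with parameters `(ν, c)` (`ν > 0`);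
* `IsSineCascade.eq_universal` — **every** `IsSineCascade ν c e` satisfies `e_k(t) = ν (c/ν)^k E_k(νt)` for `t ≥ 0`;
* `cascadeSolution_sine_eq_universal` — the same for the explicit object `cascadeSolution ν (sineDatum c)`;
* `IsSineCascade.eq_smul_pow_of_datum` — two sine cascades with the same `ν` and data `c`, `λc` differ by the factor `λ^k`;
* `IsSineCascade.unbounded_mono` — unboundedness in `k` at a fixed time is monotone in the datum: if the datum-`c` cascade
  (`c ≥ 0`) is unbounded at `t`, so is the datum-`c′` cascade for every `c′ ≥ c`.
READING: this is the dictionary sentence «`c_k(t) = ν (c/ν)^k e_k(νt)` with the universal family `e_k`» of the Z3-cascade certificate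
(`HOME/profile/z3twin/engine/cascade/README-CERT.md` §Setting), so far a pen sentence; it is what lets ONE certified table about `E` on
ONE window serve every `(ν, c)` (companion file `SheetNSLineTorusCascadeLinkCertified`). bears_on: LADDER-NS N5 / zone Z3 (row Z3-U)
→ N1 linear core. WHAT THIS IS NOT: not NS; no PDE object; no number is certified here; no definitions.
-/

namespace Summit.NavierStokesRegularity.OSWSelfSimilar
namespace SheetNSLineTorusCascade

open Finset Real Set

variable {ν c : ℝ} {e : ℕ → ℝ → ℝ}

/-! ### The two symmetries -/

/-- On the antidiagonal `i + j = k` the amplitude weights multiply: `λ^k (a b) = (λ^i a)(λ^j b)`. -/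
private theorem pow_mul_antidiagonal (lam : ℝ) {k : ℕ} {p : ℕ × ℕ} (hp : p ∈ antidiagonal k) (a b : ℝ) :
    lam ^ k * (a * b) = lam ^ p.1 * a * (lam ^ p.2 * b) := by
  have hsum : p.1 + p.2 = k := mem_antidiagonal.mp hp
  rw [← hsum, pow_add]
  ring

/-- **AMPLITUDE HOMOGENEITY.** If `e` is the sine cascade with parameters `(ν, c)` then `(k, t) ↦ λ^k e_k(t)` is the sine cascade with
parameters `(ν, λc)`, for every real `λ`. [new here — MODEL] -/
theorem IsSineCascade.smul_pow (he : IsSineCascade ν c e) (lam : ℝ) :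
    IsSineCascade ν (lam * c) (fun k t => lam ^ k * e k t) where
  zero t := by simp [he.zero]
  cont k := continuousOn_const.mul (he.cont k)
  ode k t ht := by
    have h := (he.ode k t ht).const_mul (lam ^ k)
    refine h.congr_deriv ?_
    rw [mul_sub, ← mul_assoc (lam ^ k) (1 / 2), mul_comm (lam ^ k) (1 / 2), mul_assoc (1 / 2), mul_sum]
    congr 1
    · congr 1
      exact sum_congr rfl fun p hp => pow_mul_antidiagonal lam hp _ _
    · ring
  one_init := by simp [he.one_init]
  init_zero k hk := by simp [he.init_zero k hk]

/-- **TIME/VISCOSITY SCALING.** If `e` is the sine cascade with parameters `(ν, c)` then `(k, t) ↦ κ e_k(κt)` is the sine cascade with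
parameters `(κν, κc)`, for every `κ > 0`. [new here — MODEL] -/
theorem IsSineCascade.timeScale (he : IsSineCascade ν c e) {κ : ℝ} (hκ : 0 < κ) :
    IsSineCascade (κ * ν) (κ * c) (fun k t => κ * e k (κ * t)) where
  zero t := by simp [he.zero]
  cont k := by
    refine continuousOn_const.mul ((he.cont k).comp (continuous_const.mul continuous_id).continuousOn fun t ht => ?_)
    exact mul_nonneg hκ.le ht
  ode k t ht := by
    have hκt : 0 < κ * t := mul_pos hκ ht
    have h := he.ode k (κ * t) hκt
    have hg : HasDerivAt (fun s : ℝ => κ * s) κ t := by simpa using (hasDerivAt_id t).const_mul κ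
    have hc : HasDerivAt (fun s => e k (κ * s))
        (((1 / 2) * (∑ p ∈ antidiagonal k, e p.1 (κ * t) * e p.2 (κ * t)) - ν * (k : ℝ) ^ 2 * e k (κ * t)) * κ) t :=
      h.comp t hg
    refine (hc.const_mul κ).congr_deriv ?_
    have hsum : ∑ p ∈ antidiagonal k, κ * e p.1 (κ * t) * (κ * e p.2 (κ * t))
        = κ ^ 2 * ∑ p ∈ antidiagonal k, e p.1 (κ * t) * e p.2 (κ * t) := by
      rw [mul_sum]
      exact sum_congr rfl fun p _ => by ring
    rw [hsum]
    ring
  one_init := by simp [he.one_init]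
  init_zero k hk := by simp [he.init_zero k hk]

/-! ### The universal family `E = cascadeSolution 1 (sineDatum 1)` -/

/-- **Every `(ν, c)` is a rescaling of the universal family:** `(k, t) ↦ ν (c/ν)^k E_k(νt)` is the sine cascade with parameters
`(ν, c)` (`ν > 0`), where `E = cascadeSolution 1 (sineDatum 1)`. [new here — MODEL] -/
theorem isSineCascade_universal_scaled (hν : 0 < ν) (c : ℝ) :
    IsSineCascade ν c (fun k t => ν * (c / ν) ^ k * cascadeSolution 1 (sineDatum 1) k (ν * t)) := by
  have h1 : IsSineCascade 1 1 (cascadeSolution 1 (sineDatum 1)) := isSineCascade_cascadeSolution 1 1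
  have h3 := (h1.timeScale hν).smul_pow (c / ν)
  have hν0 : ν ≠ 0 := hν.ne'
  convert h3 using 2
  · rw [mul_one]
  · field_simp
  · ring

/-- **THE DICTIONARY.** Every sine cascade with parameters `(ν, c)`, `ν > 0`, is the rescaled universal family:
`e_k(t) = ν (c/ν)^k E_k(νt)` for all `k` and all `t ≥ 0`. [new here — MODEL] -/
theorem IsSineCascade.eq_universal (he : IsSineCascade ν c e) (hν : 0 < ν) :
    ∀ k : ℕ, ∀ t : ℝ, 0 ≤ t → e k t = ν * (c / ν) ^ k * cascadeSolution 1 (sineDatum 1) k (ν * t) :=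
  he.unique (isSineCascade_universal_scaled hν c)

/-- The explicit object from the sine datum is the rescaled universal family:
`cascadeSolution ν (sineDatum c) k t = ν (c/ν)^k E_k(νt)` for `t ≥ 0` (`ν > 0`). [new here — MODEL] -/
theorem cascadeSolution_sine_eq_universal (hν : 0 < ν) (c : ℝ) :
    ∀ k : ℕ, ∀ t : ℝ, 0 ≤ t →
      cascadeSolution ν (sineDatum c) k t = ν * (c / ν) ^ k * cascadeSolution 1 (sineDatum 1) k (ν * t) :=
  (isSineCascade_cascadeSolution ν c).eq_universal hν

/-- At `ν = 1`: `cascadeSolution 1 (sineDatum c) k t = c^k E_k(t)` for `t ≥ 0`. [new here — MODEL] -/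
theorem cascadeSolution_sine_one_eq_universal (c : ℝ) :
    ∀ k : ℕ, ∀ t : ℝ, 0 ≤ t → cascadeSolution 1 (sineDatum c) k t = c ^ k * cascadeSolution 1 (sineDatum 1) k t := by
  intro k t ht
  have h := cascadeSolution_sine_eq_universal one_pos c k t ht
  simpa using h

/-- **Amplitude transfer between two data at the same viscosity** (any `ν`): if `e` is the datum-`c` sine cascade and `e′` the
datum-`λc` sine cascade, then `e′_k(t) = λ^k e_k(t)` for `t ≥ 0`. [new here — MODEL] -/
theorem IsSineCascade.eq_smul_pow_of_datum (he : IsSineCascade ν c e) {lam : ℝ} {e' : ℕ → ℝ → ℝ}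
    (he' : IsSineCascade ν (lam * c) e') : ∀ k : ℕ, ∀ t : ℝ, 0 ≤ t → e' k t = lam ^ k * e k t :=
  he'.unique (he.smul_pow lam)

/-- **Unboundedness is monotone in the datum.** If the datum-`c` sine cascade (`c ≥ 0`, any `ν`) has coefficients unbounded above
in `k` at a time `t ≥ 0`, then so has the datum-`c′` sine cascade for every `c′ ≥ c`. [new here — MODEL] -/
theorem IsSineCascade.unbounded_mono (he : IsSineCascade ν c e) (hc : 0 ≤ c) {c' : ℝ} (hcc' : c ≤ c') {e' : ℕ → ℝ → ℝ}
    (he' : IsSineCascade ν c' e') {t : ℝ} (ht : 0 ≤ t) (hunb : ∀ M : ℝ, ∃ k : ℕ, M < e k t) :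
    ∀ M : ℝ, ∃ k : ℕ, M < e' k t := by
  intro M
  rcases eq_or_lt_of_le hc with h0 | hcpos
  · -- `c = 0`: the datum-`0` cascade vanishes identically (`e_k = 0^k e_k`), so `hunb` is absurd at `M = 0`
    subst h0
    obtain ⟨k, hk⟩ := hunb 0
    have hz := he.eq_smul_pow_of_datum (lam := 0) (e' := e) (by simpa using he) k t ht
    rcases Nat.eq_zero_or_pos k with hk0 | hkpos
    · subst hk0
      rw [he.zero] at hk
      exact absurd hk (lt_irrefl 0)
    · rw [zero_pow hkpos.ne', zero_mul] at hz
      rw [hz] at hk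
      exact absurd hk (lt_irrefl 0)
  · set lam : ℝ := c' / c with hlam
    have hlam1 : 1 ≤ lam := by rw [hlam, le_div_iff₀ hcpos]; linarith
    have hc'eq : c' = lam * c := by rw [hlam]; field_simp
    have hrel := he.eq_smul_pow_of_datum (lam := lam) (e' := e') (hc'eq ▸ he')
    obtain ⟨k, hk⟩ := hunb (max M 0)
    refine ⟨k, ?_⟩
    rw [hrel k t ht]
    have hek : 0 ≤ e k t := le_trans (le_max_right _ _) hk.le
    have hpow : (1 : ℝ) ≤ lam ^ k := one_le_pow₀ hlam1
    calc M ≤ max M 0 := le_max_left _ _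
      _ < e k t := hk
      _ = 1 * e k t := (one_mul _).symm
      _ ≤ lam ^ k * e k t := mul_le_mul_of_nonneg_right hpow hek

end SheetNSLineTorusCascade
end Summit.NavierStokesRegularity.OSWSelfSimilar
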